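import Literature.AlgebraicGeometry.Resolution.ArithmeticalThreefoldsDescentHeadModel
import Literature.AlgebraicGeometry.Resolution.RankOneReductionTrackedLift
import Literature.AlgebraicGeometry.Resolution.RankOneReductionTrackedStep
import HarnessLib

/-!
# Cossart–Piltant 2019, Prop. 4.8: the regular model of `Â/P̂₁` at `v̂` with `K`-finite
# denominators, by Novacoski–Spivakovsky's composite-valuation lifting along the `K`-bounded
# coarsening of `v̂`

Topic: `Literature/AlgebraicGeometry/Resolution` (proofs only; no new notions, no new named
facts). In the proof of Prop. 4.8 of Cossart–Piltant (J. Algebra 529 (2019) = arXiv:1412.0868;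
arXiv v1 Prop. 4.6, pp. 52–53) the regular model `𝒪_{Ŷ,ŷ}` of the formal branch `Â/P̂₁` at the
extension `v̂` is taken from Thm. 1.1 (ii) for `Spec Â` ("`Ŷ → Spec Â` an isomorphism above
`Spec Â_g`"), so that its denominators are `K`-FINITE — which is what the descent (Lemma 4.7,
(510)–(512); `exists_adjoin_isRegularLocalRing_of_model`) needs. This file obtains such a model
WITHOUT patching over `Spec Â`, by local uniformization alone, organised along the composite
structure of `v̂`:

* `exists_valuationSubring_boundedBy` — the **`K`-bounded coarsening** `O₁ ⊇ O'` of `v̂`: the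
  elements of `K̂₁` whose value is bounded by the value of some element of `K^×` form a
  valuation ring (the coarsening of `v̂` by the convex subgroup generated by `v(K^×)`); its
  units are the `K`-finite elements (`exists_valuation_le_of_mem_boundedBy_of_valuation_eq_one`),
  its centre on `Â/P̂₁` is the prime `P∞` of `K`-infinitesimal elements.
* `exists_model_finiteDenominators_of_residualLU` — for ANY Noetherian base `R → K̂₁ = Frac`
  (`R = Â`): if `R̄ = im R` is regular at the centre of `O₁` and the residual valuation of
  `v̂ = ν₁ ∘ ν₂` admits local uniformization on `R̄/P∞` (Novacoski–Spivakovsky's hypothesis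
  `h₂`, verbatim), then there is a finite `t₀ ⊆ K̂₁` with `R[t₀] ⊆ O'`, `(R[t₀])_{𝔪_{v̂} ∩ R[t₀]}`
  regular, and every `z ∈ t₀` of the form `x/a`, `a, x ∈ R`, `v̂(a) ≥ v̂(ι b)` for some
  `b ∈ K^×` — by the TRACKED lifting steps `novacoskiSpivakovsky2014_cor217_tracked`,
  `novacoskiSpivakovsky2014_step_tracked` (the new models stay inside `R̄_{P∞}`).
* `exists_adjoin_isRegularLocalRing_of_residualLU` — hence (LU) for `A` at `v`
  (`exists_adjoin_isRegularLocalRing_of_model`) from: rank data, `hEmb`, the branch with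
  `dim Â/P̂₁ = 3`, regularity of `Â/P̂₁` at `P∞`, and local uniformization of the residual
  valuation on `(Â/P̂₁)/P∞ = Â/P∞`.

What is NOT here: regularity of `(Â/P̂₁)_{P∞}` (`A_g` regular for some `0 ≠ g ∈ 𝔪_A`, `A → Â`
regular) and local uniformization on the complete local domain `Â/P∞` (of dimension `3` when
`P∞` is minimal — Cossart–Piltant's (LU) for complete rings —, of dimension `≤ 2` otherwise —
resolution of excellent surfaces).

## Sources

* V. Cossart, O. Piltant, J. Algebra 529 (2019) 268–535 = arXiv:1412.0868, proof of Prop. 4.8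
  (arXiv v1: Prop. 4.6, pp. 52–53). [CossartPiltant2019]
* J. Novacoski, M. Spivakovsky, *Reduction of local uniformization to the rank one case*,
  EMS Ser. Congr. Rep. (2014) = arXiv:1204.4751v1: §2.1 (composite valuations), Cor. 2.17,
  §3.1. [NovacoskiSpivakovsky2014]
-/

noncomputable section

open AlgebraicGeometry CategoryTheory

namespace Literature.AlgebraicGeometry.Resolution

universe u

open IsLocalRing _root_.Polynomial Function

/-! ## The `K`-bounded coarsening of an extension `v̂ ⊇ v` -/

section Bounded

variable {K K₁ : Type u} [Field K] [Field K₁]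

/-- **The `K`-bounded coarsening of `v̂`.** For a valuation ring `O'` of `K̂₁` and a field
embedding `ι : K → K̂₁`, the elements `x` with `v̂(x) ≥ v̂(ι b)` for some `b ∈ K^×` (in
multiplicative notation `O'.valuation x ≤ O'.valuation (ι b)`) form a valuation ring `O₁ ⊇ O'` of
`K̂₁` — the valuation ring of the coarsening `ν₁` of `v̂` by the convex subgroup of its value group
generated by the values of `K^×`, so that `v̂ = ν₁ ∘ ν₂` is composite (Novacoski–Spivakovsky
§2.1). [cite: NovacoskiSpivakovsky2014, §2.1 (composite valuations)] -/
theorem exists_valuationSubring_boundedBy (O' : ValuationSubring K₁) (ι : K →+* K₁) :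
    ∃ O₁ : ValuationSubring K₁, O' ≤ O₁ ∧
      ∀ x : K₁, x ∈ O₁ ↔ ∃ b : K, b ≠ 0 ∧ O'.valuation x ≤ O'.valuation (ι b) := by
  classical
  let O₁ : ValuationSubring K₁ :=
    { carrier := {x | ∃ b : K, b ≠ 0 ∧ O'.valuation x ≤ O'.valuation (ι b)}
      mul_mem' := by
        rintro x y ⟨b, hb, hx⟩ ⟨b', hb', hy⟩
        refine ⟨b * b', mul_ne_zero hb hb', ?_⟩
        rw [map_mul, map_mul, map_mul]
        exact mul_le_mul' hx hy
      one_mem' := ⟨1, one_ne_zero, by rw [map_one, map_one, map_one]⟩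
      add_mem' := by
        rintro x y ⟨b, hb, hx⟩ ⟨b', hb', hy⟩
        rcases le_total (O'.valuation (ι b)) (O'.valuation (ι b')) with h | h
        · refine ⟨b', hb', (Valuation.map_add _ _ _).trans (max_le (hx.trans h) hy)⟩
        · refine ⟨b, hb, (Valuation.map_add _ _ _).trans (max_le hx (hy.trans h))⟩
      zero_mem' := ⟨1, one_ne_zero, by rw [map_zero]; exact zero_le⟩
      neg_mem' := by
        rintro x ⟨b, hb, hx⟩
        exact ⟨b, hb, by rw [Valuation.map_neg]; exact hx⟩
      mem_or_inv_mem' := by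
        intro x
        by_cases hx : ∃ b : K, b ≠ 0 ∧ O'.valuation x ≤ O'.valuation (ι b)
        · exact Or.inl hx
        · push Not at hx
          right
          have h1 : O'.valuation (ι 1) < O'.valuation x := hx 1 one_ne_zero
          rw [map_one, map_one] at h1
          have hx0 : x ≠ 0 := by rintro rfl; rw [map_zero] at h1; exact not_lt_zero h1
          refine ⟨1, one_ne_zero, ?_⟩
          rw [map_one, map_one, map_inv₀]
          exact inv_le_one_of_one_le₀ h1.le }
  refine ⟨O₁, fun x hx => ?_, fun x => Iff.rfl⟩
  exact ⟨1, one_ne_zero, by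
    rw [map_one, map_one]; exact (O'.valuation_le_one_iff x).mpr hx⟩

/-- The units of the `K`-bounded coarsening are `K`-finite: if `s ∈ O₁` has `ν₁(s) = 0` then
`v̂(s) ≥ v̂(ι b)`... in multiplicative notation `O'.valuation (ι b) ≤ O'.valuation s`, for some
`b ∈ K^×`. [cite: NovacoskiSpivakovsky2014, §2.1 (composite valuations)] -/
theorem exists_valuation_le_of_mem_boundedBy_of_valuation_eq_one (O' O₁ : ValuationSubring K₁)
    (ι : K →+* K₁)
    (hO₁ : ∀ x : K₁, x ∈ O₁ ↔ ∃ b : K, b ≠ 0 ∧ O'.valuation x ≤ O'.valuation (ι b))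
    {s : K₁} (hs : s ∈ O₁) (hs1 : O₁.valuation s = 1) :
    ∃ b : K, b ≠ 0 ∧ O'.valuation (ι b) ≤ O'.valuation s := by
  have hs0 : s ≠ 0 := by
    rintro rfl
    rw [map_zero] at hs1; exact zero_ne_one hs1
  have hinv : s⁻¹ ∈ O₁ :=
    (O₁.valuation_le_one_iff _).mp (by rw [map_inv₀, hs1, inv_one])
  obtain ⟨b, hb, hle⟩ := (hO₁ _).mp hinv
  have hιb0 : O'.valuation (ι b) ≠ 0 := (Valuation.ne_zero_iff _).mpr ((map_ne_zero ι).mpr hb)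
  refine ⟨b⁻¹, inv_ne_zero hb, ?_⟩
  rw [map_inv₀, map_inv₀] at *
  rw [inv_le_comm₀ (zero_lt_iff.mpr hιb0)
    (zero_lt_iff.mpr ((Valuation.ne_zero_iff _).mpr hs0))]
  exact hle

/-- Elements of `K^×` are units of the `K`-bounded coarsening. [cite: NovacoskiSpivakovsky2014, §2.1 (composite valuations)] -/
theorem valuation_boundedBy_map_eq_one (O' O₁ : ValuationSubring K₁) (ι : K →+* K₁)
    (hO₁ : ∀ x : K₁, x ∈ O₁ ↔ ∃ b : K, b ≠ 0 ∧ O'.valuation x ≤ O'.valuation (ι b))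
    {b : K} (hb : b ≠ 0) : O₁.valuation (ι b) = 1 := by
  have hmem : ι b ∈ O₁ := (hO₁ _).mpr ⟨b, hb, le_rfl⟩
  have hinv : (ι b)⁻¹ ∈ O₁ := (hO₁ _).mpr ⟨b⁻¹, inv_ne_zero hb, by rw [map_inv₀, map_inv₀, map_inv₀]⟩
  have hu : IsUnit (⟨ι b, hmem⟩ : O₁) :=
    isUnit_iff_exists_inv.mpr ⟨⟨(ι b)⁻¹, hinv⟩,
      Subtype.ext (mul_inv_cancel₀ ((map_ne_zero ι).mpr hb))⟩
  exact (O₁.valuation_eq_one_iff _).mp hu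

end Bounded

/-! ## The model with `K`-finite denominators from local uniformization of the residual valuation -/

section Composite

variable {R : Type u} [CommRing R] [IsNoetherianRing R] {K K₁ : Type u} [Field K] [Field K₁]
  [Algebra R K₁]

set_option maxHeartbeats 800000 in
/-- **A regular model of `R̄ = im(R → K̂₁)` at `v̂` with `K`-finite denominators, from
regularity of `R̄` at the centre `P∞` of the `K`-bounded coarsening `ν₁` and local
uniformization of the residual valuation `ν₂` on `R̄/P∞`** (Cossart–Piltant's `𝒪_{Ŷ,ŷ}`, built
by Novacoski–Spivakovsky's lifting instead of patching). Data: a Noetherian ring `R` with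
`K̂₁ = {a/b}` its ring of fractions modulo the kernel, a valuation ring `O' ⊇ R̄` of `K̂₁`, a field
map `ι : K → K̂₁`, the `K`-bounded coarsening `O₁ ⊇ O'`; hypotheses: `R̄` localised at the centre
of `O₁` is regular (`hregP`), and Novacoski–Spivakovsky's `h₂` for the model `R̄ = ⊥`: above the
residue ring of `R̄` in any field `κ → κ(O₁)`, the residual valuation ring has a finitely
generated regular model. Conclusion: a finite `t₀ ⊆ K̂₁` with `R[t₀] ⊆ O'`,
`(R[t₀])_{𝔪_{v̂} ∩ R[t₀]}` regular, and each `z ∈ t₀` equal to `x/a` with `a, x ∈ R` and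
`v̂(a) ≥ v̂(ι b)` for some `b ∈ K^×`. Proof: `novacoskiSpivakovsky2014_cor217_tracked`, then
`novacoskiSpivakovsky2014_step_tracked`; the generators of the final model are `a s⁻¹` with
`a, s ∈ R̄`, `ν₁(s) = 0`, and units of `O₁` are `K`-finite.
[cite: CossartPiltant2019, proof of Prop. 4.8 (arXiv v1: Prop. 4.6, pp. 52–53)]
[cite: NovacoskiSpivakovsky2014, Cor. 2.17 and §3.1] -/
theorem exists_model_finiteDenominators_of_residualLU
    (hK₁ : ∀ z : K₁, ∃ a b : R, z = algebraMap R K₁ a / algebraMap R K₁ b)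
    (O' : ValuationSubring K₁) (ι : K →+* K₁)
    (O₁ : ValuationSubring K₁) (hO : O' ≤ O₁)
    (hO₁ : ∀ x : K₁, x ∈ O₁ ↔ ∃ b : K, b ≠ 0 ∧ O'.valuation x ≤ O'.valuation (ι b))
    (hbot : (⊥ : Subalgebra R K₁).toSubring ≤ O'.toSubring)
    (hregP : IsRegularLocalRing
      (Localization.AtPrime ((maximalIdeal O₁).comap (Subring.inclusion (hbot.trans hO)))))
    (h₂ : ∀ (κ : Type u) [Field κ] [Algebra R κ] (j : κ →+* ResidueField O₁)
      (φ : (⊥ : Subalgebra R K₁) →ₐ[R] κ),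
      (∀ a : (⊥ : Subalgebra R K₁), j (φ a) = residue O₁ ⟨(a : K₁), (hbot.trans hO) a.2⟩) →
      IsFractionRing φ.range κ →
      ∃ (B : Subalgebra R κ)
        (hB : B.toSubring ≤ ((residueValuationSubring O' O₁ hO).comap j).toSubring),
        φ.range ≤ B ∧ B.FG ∧
        IsRegularLocalRing (Localization.AtPrime
          ((maximalIdeal ((residueValuationSubring O' O₁ hO).comap j)).comap
            (Subring.inclusion hB)))) :
    ∃ t₀ : Finset K₁, ∃ _ : (Algebra.adjoin R (t₀ : Set K₁)).toSubring ≤ O'.toSubring,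
      IsRegularLocalRing (locAtCentre (Algebra.adjoin R (t₀ : Set K₁)).toSubring O') ∧
      ∀ z ∈ (t₀ : Set K₁), ∃ a x : R,
        (∃ b : K, b ≠ 0 ∧ O'.valuation (ι b) ≤ O'.valuation (algebraMap R K₁ a)) ∧
          algebraMap R K₁ a * z = algebraMap R K₁ x := by
  classical
  set A₀ : Subalgebra R K₁ := ⊥ with hA₀def
  have hA₀fg : A₀.FG := Subalgebra.fg_bot
  haveI : FaithfulSMul A₀ K₁ :=
    (faithfulSMul_iff_algebraMap_injective A₀ K₁).mpr Subtype.val_injective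
  have hfrac : IsFractionRing A₀ K₁ := by
    refine IsFractionRing.of_field (R := A₀) (K := K₁) fun z => ?_
    obtain ⟨a, b, hz⟩ := hK₁ z
    exact ⟨⟨algebraMap R K₁ a, Algebra.mem_bot.mpr ⟨a, rfl⟩⟩,
      ⟨algebraMap R K₁ b, Algebra.mem_bot.mpr ⟨b, rfl⟩⟩, hz⟩
  -- Cor. 2.17 (tracked): lift a regular model of the residual valuation
  obtain ⟨A', hA', hle', hA'fg, hregP', hregQ', htr'⟩ :=
    novacoskiSpivakovsky2014_cor217_tracked O' O₁ hO A₀ hbot hA₀fg hfrac hregP h₂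
  -- §3.1 (tracked): one more blowing up makes the model regular
  haveI : IsFractionRing A₀ K₁ := hfrac
  have hfrac' : IsFractionRing A' K₁ := isFractionRing_subalgebra_of_le A₀ A' hle'
  obtain ⟨A'', hA'', hle'', hA''fg, hreg'', htr''⟩ :=
    novacoskiSpivakovsky2014_step_tracked O' O₁ hO A' hA' hA'fg hfrac' hregP' hregQ'
  obtain ⟨t₀, ht₀⟩ := hA''fg
  have hT₀O : (Algebra.adjoin R (t₀ : Set K₁)).toSubring ≤ O'.toSubring := by rw [ht₀]; exact hA''
  refine ⟨t₀, hT₀O, ?_, ?_⟩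
  · rw [isRegularLocalRing_locAtCentre_iff hT₀O]
    have : (Algebra.adjoin R (t₀ : Set K₁)) = A'' := ht₀
    subst this
    exact hreg''
  · intro z hz
    have hzA'' : z ∈ A'' := by rw [← ht₀]; exact Algebra.subset_adjoin hz
    obtain ⟨a, ha, s, hs, hs1, rfl⟩ := htr'' z hzA''
    obtain ⟨a₁, ha₁, s₁, hs₁, hs₁1, rfl⟩ := htr' a ha
    obtain ⟨a₂, ha₂, s₂, hs₂, hs₂1, rfl⟩ := htr' s hs
    obtain ⟨ra₁, rfl⟩ := Algebra.mem_bot.mp ha₁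
    obtain ⟨rs₁, rfl⟩ := Algebra.mem_bot.mp hs₁
    obtain ⟨ra₂, rfl⟩ := Algebra.mem_bot.mp ha₂
    obtain ⟨rs₂, rfl⟩ := Algebra.mem_bot.mp hs₂
    have hbotO₁ : ∀ r : R, algebraMap R K₁ r ∈ O₁ := fun r =>
      hO (hbot (Algebra.mem_bot.mpr ⟨r, rfl⟩))
    have hs₂0 : algebraMap R K₁ rs₂ ≠ 0 := ne_zero_of_valuation_eq_one hs₂1
    have hs₁0 : algebraMap R K₁ rs₁ ≠ 0 := ne_zero_of_valuation_eq_one hs₁1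
    -- `ν₁(a₂) = 0` as well: `a₂ s₂⁻¹` is a `ν₁`-unit
    have ha₂1 : O₁.valuation (algebraMap R K₁ ra₂) = 1 := by
      have h := hs1
      rw [map_mul, map_inv₀, hs₂1, inv_one, mul_one] at h
      exact h
    have ha₂0 : algebraMap R K₁ ra₂ ≠ 0 := ne_zero_of_valuation_eq_one ha₂1
    -- the denominator `d = s₁ a₂`
    refine ⟨rs₁ * ra₂, ra₁ * rs₂, ?_, ?_⟩
    · have hd1 : O₁.valuation (algebraMap R K₁ (rs₁ * ra₂)) = 1 := by
        rw [map_mul, map_mul, hs₁1, ha₂1, mul_one]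
      exact exists_valuation_le_of_mem_boundedBy_of_valuation_eq_one O' O₁ ι hO₁ (hbotO₁ _) hd1
    · rw [map_mul, map_mul]
      field_simp

end Composite

/-! ## (LU) for `A` at `v` from the residual local uniformization -/

section Descent

variable {A : Type u} [CommRing A] [IsDomain A] [IsLocalRing A] [IsNoetherianRing A]
  {K : Type u} [Field K] [Algebra A K] [IsFractionRing A K]

/-- **(LU) for `A` at `v` from regularity of the branch at `P∞` and local uniformization of the
residual valuation** (Cossart–Piltant 2019, Prop. 4.8, geometric head, with the model
`𝒪_{Ŷ,ŷ}` built by Novacoski–Spivakovsky's composite lifting). Data as in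
`exists_adjoin_isRegularLocalRing_of_model` without the model, plus the `K`-bounded coarsening
`O₁` of `v̂` (`exists_valuationSubring_boundedBy`), regularity of `Ā = Â/P̂₁ ⊆ K̂₁` at the centre
`P∞` of `O₁`, and Novacoski–Spivakovsky's hypothesis `h₂` (a finitely generated regular model
of the residual valuation above the residue ring of `Ā`, in any field `κ → κ(O₁)`).
Conclusion: some finitely generated `A[t] ⊆ O` is regular at the centre of `O`.
[cite: CossartPiltant2019, proof of Prop. 4.8 with Lemma 4.7 and (510)–(512) (arXiv v1: Prop. 4.6, pp. 52–53)]
[cite: NovacoskiSpivakovsky2014, Cor. 2.17 and §3.1] -/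
theorem exists_adjoin_isRegularLocalRing_of_residualLU
    (k : Type u) [Field k] [Algebra k A] [Algebra.EssFiniteType k A]
    (hEmb : ∀ (Z : Scheme.{u}) [IsIntegral Z] [IsNoetherian Z], Scheme.IsRegular Z →
      Scheme.IsExcellent Z → ∀ (X : Set Z), IsClosed X → X ≠ Set.univ → topologicalKrullDim X ≤ 2 →
        ∃ (Z' : Scheme.{u}) (π : Z' ⟶ Z), IsProper π ∧ Function.Surjective π.base ∧
          (∃ U : Z.Opens, (U : Set Z) = Xᶜ ∧ IsIso (π ∣_ U)) ∧
          IsStrictNormalCrossingsDivisor Z' (π.base ⁻¹' X))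
    (O : ValuationSubring K) (hrk : Nonempty O.valuation.RankOne)
    (hAO : ∀ x : A, algebraMap A K x ∈ O)
    (hdomA : ∀ x ∈ maximalIdeal A, O.valuation (algebraMap A K x) < 1)
    -- rank data of `v` on `K`
    (r : ℕ) (hr0 : 0 < r) (fA : Fin r → A) (hfAm : ∀ i, fA i ∈ maximalIdeal A)
    (hfA0 : ∀ i, algebraMap A K (fA i) ≠ 0)
    (hind : ∀ p m : Fin r → ℕ, ∏ i, O.valuation (algebraMap A K (fA i)) ^ p i =
      ∏ i, O.valuation (algebraMap A K (fA i)) ^ m i → p = m)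
    (hdepK : ∀ (d : ℕ) (I : Finset (Fin d)) (a : Fin d → K), r < I.card → (∀ k, a k ≠ 0) →
      ∃ c : Fin d → ℤ, (∀ k, k ∉ I → c k = 0) ∧ c ≠ 0 ∧
        ∏ k, O.valuation (a k) ^ (c k).toNat = ∏ k, O.valuation (a k) ^ (-c k).toNat)
    -- the formal branch and the extension
    {K₁ : Type u} [Field K₁] [Algebra (AdicCompletion (maximalIdeal A) A) K₁]
    (hP₁ : RingHom.ker (algebraMap (AdicCompletion (maximalIdeal A) A) K₁) ∈
      minimalPrimes (AdicCompletion (maximalIdeal A) A))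
    (hK₁ : ∀ z : K₁, ∃ a b : AdicCompletion (maximalIdeal A) A,
      z = algebraMap _ K₁ a / algebraMap _ K₁ b)
    (hdimP₁ : ringKrullDim (AdicCompletion (maximalIdeal A) A ⧸
      RingHom.ker (algebraMap (AdicCompletion (maximalIdeal A) A) K₁)) = 3)
    (ι : K →+* K₁) (hι : ι.comp (algebraMap A K) =
      (algebraMap (AdicCompletion (maximalIdeal A) A) K₁).comp
        (algebraMap A (AdicCompletion (maximalIdeal A) A)))
    (O' : ValuationSubring K₁)
    (hRO' : ∀ x : AdicCompletion (maximalIdeal A) A, algebraMap _ K₁ x ∈ O')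
    (halgO' : ∀ y : O', ∃ p : Polynomial (AdicCompletion (maximalIdeal A) A),
      (∃ i, p.coeff i ∉ (maximalIdeal A).map (algebraMap A (AdicCompletion (maximalIdeal A) A))) ∧
      O'.valuation (p.eval₂ (algebraMap (AdicCompletion (maximalIdeal A) A) K₁) y) < 1)
    (hO : O'.comap ι = O)
    -- the `K`-bounded coarsening, regularity at `P∞`, residual local uniformization
    (O₁ : ValuationSubring K₁) (hO'O₁ : O' ≤ O₁)
    (hO₁ : ∀ x : K₁, x ∈ O₁ ↔ ∃ b : K, b ≠ 0 ∧ O'.valuation x ≤ O'.valuation (ι b))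
    (hbot : (⊥ : Subalgebra (AdicCompletion (maximalIdeal A) A) K₁).toSubring ≤ O'.toSubring)
    (hregP : IsRegularLocalRing
      (Localization.AtPrime ((maximalIdeal O₁).comap (Subring.inclusion (hbot.trans hO'O₁)))))
    (h₂ : ∀ (κ : Type u) [Field κ] [Algebra (AdicCompletion (maximalIdeal A) A) κ]
      (j : κ →+* ResidueField O₁)
      (φ : (⊥ : Subalgebra (AdicCompletion (maximalIdeal A) A) K₁) →ₐ[AdicCompletion (maximalIdeal A) A] κ),
      (∀ a : (⊥ : Subalgebra (AdicCompletion (maximalIdeal A) A) K₁),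
        j (φ a) = residue O₁ ⟨(a : K₁), (hbot.trans hO'O₁) a.2⟩) →
      IsFractionRing φ.range κ →
      ∃ (B : Subalgebra (AdicCompletion (maximalIdeal A) A) κ)
        (hB : B.toSubring ≤ ((residueValuationSubring O' O₁ hO'O₁).comap j).toSubring),
        φ.range ≤ B ∧ B.FG ∧
        IsRegularLocalRing (Localization.AtPrime
          ((maximalIdeal ((residueValuationSubring O' O₁ hO'O₁).comap j)).comap
            (Subring.inclusion hB)))) :
    ∃ (t : Finset K) (h : (Algebra.adjoin A (t : Set K)).toSubring ≤ O.toSubring),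
      IsRegularLocalRing (Localization.AtPrime
        (Ideal.comap (Subring.inclusion h) (maximalIdeal O))) := by
  haveI : IsNoetherianRing (AdicCompletion (maximalIdeal A) A) :=
    isNoetherianRing_adicCompletion_maximalIdeal A
  obtain ⟨t₀, hT₀O, hreg, hden₀⟩ :=
    exists_model_finiteDenominators_of_residualLU hK₁ O' ι O₁ hO'O₁ hO₁ hbot hregP h₂
  exact exists_adjoin_isRegularLocalRing_of_model k hEmb O hrk hAO hdomA r hr0 fA hfAm hfA0 hind
    hdepK hP₁ hK₁ hdimP₁ ι hι O' hRO' halgO' hO t₀ hT₀O hreg hden₀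

end Descent

end Literature.AlgebraicGeometry.Resolution

end
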